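import Summits.CriticalPhenomena.SAWScalingLimit.Theses.SAWParafermion
import Summits.CriticalPhenomena.SAWScalingLimit.Theses.SAWRenewalTightness
import Summits.CriticalPhenomena.SAWScalingLimit.Theorems.SAWTotalPositivitySAWTraversalBoundShellCrossing
import Summits.CriticalPhenomena.SAWScalingLimit.Theorems.SAWRenewalTightnessEventualTightSplit
import Literature.Probability.RandomPlanarGeometry.SLEConvergenceCriterion

/-!
# Stub `stub_tightZ2` of the line `registered` for the crux `SurfaceUniversality`
# (stmt-CriticalPhenomena-6964) is the shared tightness item stmt-1881, i.e. stmt-1372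

Route `SAWCompassLattice` (sub-problem `SAWScalingLimit`). The lead's reshaped skeleton
(`Cruxes/SurfaceUniversality/Lines/birth.lean`) proves the crux from three Lipschitz-level stubs and
ONE tightness-strength input, `stub_tightZ2 : SAWParafermion.EventualTight` — BY NAME the shared
item stmt-CriticalPhenomena-1881 (eventual tightness `IsTightAlongMesh` of the critical `ℤ²` SAW
curve laws `SAW.law D.carrier δ (a δ) (b δ)` pushed to `CurveClass ℂ`, along `δ → 0⁺`, for every
Dobrushin domain and endpoint approximation). That item is research-open; the STAFFED form of the
same question is route `SAWRenewalTightness`'s crux stmt-CriticalPhenomena-1372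
(`SAWRenewalTightness.EventualTight`: `∃ δ₀ > 0`, the image laws over `δ ∈ (0, δ₀]` form a tight
set), which has its own crux directory `Cruxes/EventualTight/` and split
`ConfinementPositivity → BulkShellTight → EventualTight`.

This file ties the stub to that crux, so that a proof of stmt-1372 closes `stub_tightZ2` by name
and nobody attacks the `SAWParafermion` copy separately:

* `eventualTight_of_renewal : SAWRenewalTightness.EventualTight → SAWParafermion.EventualTight` —
  the bridge `isTightAlongMesh_of_isTightMeasureSet_image` (the SAW observable `γ ↦ γ.curve` is
  a.e.-measurable at every mesh, `SAW.aemeasurable_curve`: discrete σ-algebra);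
* `renewal_of_eventualTight`, `eventualTight_iff_renewal` — the converse and the equivalence
  stmt-1881 ⟺ stmt-1372, through the landed `renewalEventualTight_iff_eventualTight`
  (stmt-1372 ⟺ `SAWTotalPositivity.EventualTight`, whose body is syntactically that of
  `SAWParafermion.EventualTight`; the converse runs through the proved Aizenman–Burchard criterion
  `TightOfShellCrossing_proof`);
* `eventualTight_iff_sawTraversalBound` — equivalently the Aizenman–Burchard hypothesis (H1) for
  the critical SAW, `SAWTotalPositivity.SAWTraversalBound` (stmt-1880);
* `eventualTight_of_subs` — hence the two current leaves of the staffed split of stmt-1372,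
  `ConfinementPositivity` (stmt-17587) and `BulkShellTight` (stmt-17588), already imply the stub
  (through the landed glue `EventualTightOfSubs_proof`, stmt-17589);
* `isTightAlongMesh_law_of_renewal` — the pointwise form the skeleton's one-sided Prokhorov upgrade
  `tendsto_sub_of_isTightAlongMesh` consumes.

No named unproved fact is used; everything here is glue over landed theorems.
-/

noncomputable section

namespace Summit.CriticalPhenomena.SAWScalingLimit.Theorems.SurfaceUniversality

open MeasureTheory Filter Topology Set
open Literature.Probability.RandomPlanarGeometry
open Literature.Probability.LatticeModels (Site)
open Summit.CriticalPhenomena.SAWScalingLimit.Theses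

/-- **stmt-1372 ⟹ stmt-1881 (`stub_tightZ2`).** Route `SAWRenewalTightness`'s set-form eventual
tightness (`∃ δ₀ > 0`, the pushed-forward critical SAW laws over `δ ∈ (0, δ₀]` form a tight set)
gives tightness along the mesh filter `𝓝[>] 0` of the critical `ℤ²` SAW curve laws for every
Dobrushin domain and endpoint approximation, i.e. `SAWParafermion.EventualTight`: the bridge
`isTightAlongMesh_of_isTightMeasureSet_image`, the observable `γ ↦ γ.curve` being a.e.-measurable
at every mesh (`SAW.aemeasurable_curve`). [folklore] -/
theorem eventualTight_of_renewal :
    SAWRenewalTightness.EventualTight → SAWParafermion.EventualTight := by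
  intro h D a b hab
  obtain ⟨δ₀, hδ₀, hT⟩ := h D a b hab
  exact isTightAlongMesh_of_isTightMeasureSet_image
    (Y := fun δ (γ : SAW.DomainSAW D.carrier δ (a δ) (b δ)) => γ.curve)
    (P := fun δ => SAW.law D.carrier δ (a δ) (b δ))
    (Eventually.of_forall fun δ => SAW.aemeasurable_curve D.carrier δ (a δ) (b δ)) hδ₀ hT

/-- **stmt-1881 ⟹ stmt-1372.** Conversely, tightness along the mesh of the critical `ℤ²` SAW curve
laws gives the set form on an initial mesh interval: `SAWParafermion.EventualTight` has the body of
`SAWTotalPositivity.EventualTight`, and the landed `renewalEventualTight_iff_eventualTight` runs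
`←` through compactness bounds on traversal counts (`sawTraversalBound_of_eventualTight`) and the
proved Aizenman–Burchard criterion (`TightOfShellCrossing_proof`). [folklore] -/
theorem renewal_of_eventualTight :
    SAWParafermion.EventualTight → SAWRenewalTightness.EventualTight :=
  fun h => renewalEventualTight_iff_eventualTight.2 h

/-- **stmt-1881 ⟺ stmt-1372.** The stub `stub_tightZ2 : SAWParafermion.EventualTight` of the line
`registered` for `SurfaceUniversality` (stmt-6964) is EXACTLY route `SAWRenewalTightness`'s crux
`EventualTight` (stmt-1372): one open proposition, uniform-in-mesh precompactness of the critical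
planar self-avoiding walk. [folklore] -/
theorem eventualTight_iff_renewal :
    SAWParafermion.EventualTight ↔ SAWRenewalTightness.EventualTight :=
  ⟨renewal_of_eventualTight, eventualTight_of_renewal⟩

/-- **stmt-1881 ⟺ stmt-1880.** Equivalently, `stub_tightZ2` is the Aizenman–Burchard hypothesis
(H1) for the critical square-lattice SAW, `SAWTotalPositivity.SAWTraversalBound` (power-law bound on
the probability of `k` traversals of an annulus, shell-dependent mesh threshold), through the landed
`sawTraversalBound_iff_renewalEventualTight`. [folklore] -/
theorem eventualTight_iff_sawTraversalBound :
    SAWParafermion.EventualTight ↔ SAWTotalPositivity.SAWTraversalBound :=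
  eventualTight_iff_renewal.trans sawTraversalBound_iff_renewalEventualTight.symm

/-- **stmt-17587 ∧ stmt-17588 ⟹ stmt-1881.** The two leaves of route `SAWRenewalTightness`'s split
of its crux — restriction positivity for nested Dobrushin domains with common marked-point sockets
(`ConfinementPositivity`) and per-shell tightness of the traversal counts on interior shells
(`BulkShellTight`) — imply `stub_tightZ2`, through the landed glue `EventualTightOfSubs_proof`
(`ConfinementPositivity → BulkShellTight → EventualTight`, the proved Aizenman–Burchard criterion)
and `eventualTight_of_renewal`. [folklore] -/
theorem eventualTight_of_subs (hC : SAWRenewalTightness.ConfinementPositivity)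
    (hB : SAWRenewalTightness.BulkShellTight) : SAWParafermion.EventualTight :=
  eventualTight_of_renewal (EventualTightOfSubs_proof hC hB)

/-- **Pointwise consumer form.** Under route `SAWRenewalTightness`'s `EventualTight` (stmt-1372),
the critical `ℤ²` SAW curve laws of one Dobrushin domain with one endpoint approximation are tight
along the mesh — the hypothesis shape of the skeleton's one-sided Prokhorov upgrade
`tendsto_sub_of_isTightAlongMesh`. [folklore] -/
theorem isTightAlongMesh_law_of_renewal (h : SAWRenewalTightness.EventualTight)
    {D : DobrushinDomain} {a b : ℝ → Site 2} (hab : SAW.IsEndpointApprox D a b) :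
    IsTightAlongMesh (fun δ (γ : SAW.DomainSAW D.carrier δ (a δ) (b δ)) => γ.curve)
      (fun δ => SAW.law D.carrier δ (a δ) (b δ)) :=
  eventualTight_of_renewal h D a b hab

end Summit.CriticalPhenomena.SAWScalingLimit.Theorems.SurfaceUniversality

end
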